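import Summits.Langlands.Langlands.Theses.DyadicOddResidue
import Literature.NumberTheory.Automorphic.FontaineMazurGL2PotCrystallineOrdinary
import Literature.NumberTheory.Automorphic.FontaineMazurGL2DyadicNearlyOrdinaryDihedral
import HarnessLib

/-!
# Support `DyadicOddResidue.DyadicDihedralPrintedCellsFM` (stmt-Langlands-18103):
# the two printed dihedral cells at `ℓ = 2`, from the named facts of Thorne 2026 and Allen 2014

The support item `DyadicDihedralPrintedCellsFM` of route `Langlands/DyadicOddResidue` is, by the
route's convention, typed FACT-FREE: for a continuous `ρ : Γ_ℚ → GL₂(ℚ̄₂)` which is residually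
absolutely irreducible with solvable (dihedral) residual image, irreducible, odd, unramified almost
everywhere and de Rham at `2` with distinct labelled Hodge–Tate weights, IF

* (cell of Thorne 2026, Thm. D at `p = 2`) some Tate twist `ρ ⊗ ε₂^a` is Skinner–Wiles-ordinary of
  weight `2` at the place above `2`, de Rham for Fontaine's pinned datum and potentially
  crystalline (`N = 0` on every attached Weil–Deligne representation), OR
* (cell of Allen 2014, `F = ℚ`) Allen's condition (5) holds for the residual representation and
  some Tate twist `ρ ⊗ ε₂^a` is Skinner–Wiles-ordinary of a weight `k ≥ 2` at the place above `2`
  with `det(ρ ⊗ ε₂^a) · ε₂^{1−k}` of finite order,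

THEN some Tate twist `ρ ⊗ ε₂^m` is attached to a newform `f ∈ S_k(Γ₁(N))` away from `2N`
(`IsGaloisRepOfNewform1`).  The two disjuncts are VERBATIM the hypotheses (at `p = 2`) of the
accepted named facts

* `Literature.NumberTheory.Automorphic.Thorne2026_fontaineMazurGL2_potCrystallineOrdinary`
  (J. A. Thorne, arXiv:2608.07186, Theorem D — any prime, any residual image), and
* `Literature.NumberTheory.Automorphic.Allen2014_modularity_nearlyOrdinaryDihedral_Q`
  (P. B. Allen, Compositio Math. 150 (2014), Theorem of the Introduction, `F = ℚ`),

and the conclusion is their common conclusion; so the item follows from the two facts by a case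
split (`dyadicDihedralPrintedCellsFM_of_facts`, this file).  Both facts are undischarged named
facts (D-0014) — two printed `2`-adic modularity(-lifting) theorems, irreducibly XL — so the
result here is CONDITIONAL on exactly these two names; the item's own (fact-free) signature is
proved the day both are discharged (`dyadicDihedralPrintedCellsFM_of_facts T_holds A_holds`).
The residual hypotheses are not used on the Thorne cell, irreducibility is not used on the Allen
cell, and the de Rham / Hodge–Tate-regularity hypothesis at `2` is used on neither (each printed
theorem carries its own `p`-adic Hodge-theoretic hypothesis inside its cell).

No statement of the route file is altered.  Sorry-free; axioms `propext`, `Classical.choice`,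
`Quot.sound`.
-/

namespace Summit.Langlands.Langlands.Theorems

set_option linter.dupNamespace false -- project-wide option; `Summit.Langlands.Langlands` is the mandated namespace

open Summit.Langlands.Langlands.Theses.DyadicOddResidue

/-- **The two printed dihedral cells at `ℓ = 2` (support `DyadicDihedralPrintedCellsFM`,
stmt-Langlands-18103) follow from the named facts of Thorne 2026 (Thm. D) and Allen 2014
(Theorem, `F = ℚ`).**  For `ρ : Γ_ℚ → GL₂(ℚ̄₂)` continuous, residually absolutely irreducible with
solvable residual image, irreducible, odd, unramified a.e. and de Rham at `2` with distinct
labelled Hodge–Tate weights: if some Tate twist of `ρ` is weight-`2` Skinner–Wiles-ordinary, de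
Rham and potentially crystalline at `2` (Thorne's cell), or Allen's condition (5) holds and some
Tate twist is nearly ordinary of a weight `k ≥ 2` with `det · ε₂^{1−k}` of finite order (Allen's
cell), then some Tate twist `ρ ⊗ ε₂^m` is the Galois representation of a newform away from `2N`.
Proof: case on the cell; Thorne's fact at `p = 2` closes the first (its hypothesis is the cell
verbatim), Allen's fact closes the second.  CONDITIONAL on the two named facts (trust base:
exactly `Thorne2026_fontaineMazurGL2_potCrystallineOrdinary`,
`Allen2014_modularity_nearlyOrdinaryDihedral_Q`).
[cite: Thorne2026FontaineMazurGL2, Theorem D (Introduction, p. 3 of arXiv:2608.07186)]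
[cite: Allen2014, Theorem of the Introduction (arXiv:1301.1113, p. 2)] -/
theorem dyadicDihedralPrintedCellsFM_of_facts
    (hT : Literature.NumberTheory.Automorphic.Thorne2026_fontaineMazurGL2_potCrystallineOrdinary)
    (hA : Literature.NumberTheory.Automorphic.Allen2014_modularity_nearlyOrdinaryDihedral_Q) :
    DyadicDihedralPrintedCellsFM := by
  intro ρ hres hsol hirr hodd hunr _hdR hcell
  rcases hcell with hThorne | hAllen
  · -- Thorne 2026, Thm. D at `p = 2`: the cell is its twisted hypothesis verbatim
    exact hT 2 ρ hunr hirr hodd hThorne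
  · -- Allen 2014 (`F = ℚ`): condition (5) and the nearly ordinary Tate twist
    exact hA ρ hunr hodd hres hsol hAllen.1 hAllen.2

end Summit.Langlands.Langlands.Theorems
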